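import Mathlib.InformationTheory.KullbackLeibler.Basic
import Mathlib.Probability.Martingale.Basic
import Mathlib.MeasureTheory.Integral.IntervalIntegral.Basic
import Mathlib.MeasureTheory.Group.Measure
import Mathlib.Topology.Order.ProjIcc
import Mathlib.Analysis.Normed.Lp.MeasurableSpace
import Literature.Analysis.FunctionSpaces.TorusFluidGlue
import Literature.Probability.Process.BrownianMotion
import Literature.Probability.Process.KolmogorovExtensionProofs
import Literature.Probability.Process.PathSpaceBorel
import HarnessLib

/-!
# The Brödinger problem (Brenier–Schrödinger entropic least action for viscous incompressible fluids)

Topic `Analysis/FluidPDE`. This file is an **interface**: it defines the objects of the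
entropic interpolation problem of Arnaudon–Cruzeiro–Léonard–Zambrini for incompressible viscous
fluids on the flat torus `𝕋ᵈ = UnitAddTorus d` — nicknamed the *Brödinger* ("Bredinger")
problem, a hybrid of Brenier's relaxed least-action problem and the Schrödinger problem
(Arnaudon–Cruzeiro–Léonard–Zambrini, AIHP PS 56 (2020) = arXiv:1704.02126, §1, problem (Bdg) and
its "fundamental example on the torus" (14); Baradat–Monsaingeon, ARMA 235 (2020) =
arXiv:1810.12036, §2.1 "Brödinger problem"; Brenier, *Examples of Hidden Convexity in Nonlinear
PDEs* (2020), §5.3, Remark 2) — and proves nothing about existence or uniqueness of minimisers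
(those are separate, cite-tagged facts: ACLZ Prop. 2 / Cor. 7, existence and uniqueness iff
`H(π | vol ⊗ vol) < ∞`).

## The problem (ACLZ (14); Baradat–Monsaingeon §2.1)

Data: a viscosity `ν > 0`, a time window `[t₀, t₁]`, and an endpoint coupling
`π ∈ 𝒫(𝕋ᵈ × 𝕋ᵈ)`. Path space `Ω = C([t₀, t₁]; 𝕋ᵈ)` with its Borel σ-algebra (= the σ-algebra of
the coordinate process, `Literature.Probability.Process.borel_continuousMap_eq_iSup_comap_eval`).
Reference measure: the **reversible Brownian path measure** `R = ∫ Rˣ vol(dx)`, `Rˣ` the law of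
`x + √a B` (ACLZ Def. 1), here with diffusion coefficient `a = 2ν`, i.e. generator `νΔ` — the
normalisation under which the associated fluid equation (ACLZ Thm. 24: the backward velocity of the
minimiser solves `(∂ₜ + v·∇)v = (a/2)Δv − ∇p'`) is Navier–Stokes with viscosity `ν`, and under
which the laws of `dX = u dt + √(2ν) dW` are absolutely continuous with respect to `R`
(Baradat–Monsaingeon's `R^ν` has variance parameter `ν`, i.e. it is our measure at viscosity `ν/2`).
Problem: minimise the relative entropy `H(P | R)` among probability measures `P` on `Ω` with
`(X_t)_# P = vol` for **every** `t ∈ [t₀, t₁]` (incompressibility) and `(X_{t₀}, X_{t₁})_# P = π`.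
By Girsanov, `H(P | R) = (1/4ν) E_P ∫ |v^P_t|² dt` for such `P` (ACLZ (13)), the expected kinetic
action of the forward (Nelson) drift.

## Main definitions (namespace `Literature.Analysis.FluidPDE`)

* `TorusPath d t₀ t₁`: the path space `C([t₀, t₁]; 𝕋ᵈ)` (a `def` synonym of
  `C(Set.Icc t₀ t₁, UnitAddTorus d)`, so that its Borel `MeasurableSpace`/`BorelSpace` instances are
  global on the synonym without being declared on Mathlib's `C(X, Y)`; compare the scoped
  `PathBorel` instances of `Probability/RandomPlanarGeometry`), with the coordinate process
  `TorusPath.eval`, `TorusPath.endpoints`, the constant extension `TorusPath.extend` to real times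
  and the raw canonical filtration `TorusPath.canonicalFiltration`.
* `reversibleBrownianLaw d ν t₀ t₁ : Measure (TorusPath d t₀ t₁)`: the reversible Brownian path
  measure `R` (ACLZ Def. 1), **constructed** as the law of `t ↦ x + proj(√(2ν) W_{t−t₀})` under
  `vol ⊗ (preWienerMeasure)^{⊗ d}`, `W` the vector of `d` independent copies of the tree's
  canonical Brownian motion `Literature.Probability.Process.brownian` (unconditionally a Brownian
  motion: `KolmogorovExtensionProofs`, `BrownianMotionProofs`).
* `BrodingerProblem d`: the data `(ν, t₀, t₁, π)` with `0 < ν`, `t₀ < t₁`;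
  `BrodingerProblem.IsAdmissible`, `BrodingerProblem.entropy` (Mathlib `InformationTheory.klDiv`,
  valued in `ℝ≥0∞`), `BrodingerProblem.value`, and `IsBrodingerMinimiser`.
* The **classical embedding** `u ↦ Pᵘ` of a (smooth) velocity field: `IsDriftLaw ν t₀ t₁ u P` says
  that `P` is the law, started from `vol`, of `dX = u(t, X) dt + √(2ν) dW` on the window, in the
  Stroock–Varadhan martingale-problem form (ACLZ p. 7: `L_t = v·∇ + aΔ/2`; Karatzas–Shreve §5.4,
  Def. 4.10, Prop. 4.11); `driftLaw ν t₀ t₁ u` is a measure chosen with this property, and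
  `BrodingerProblem.ofPathMeasure` poses the Brödinger problem with a path measure's own endpoint
  coupling — so that "the classical Navier–Stokes flow is the (unique) Brödinger minimiser for its
  own endpoint coupling on short windows" is typable.

## API proved here

`IsAdmissible.isProbabilityMeasure`, `IsAdmissible.fst_coupling` / `snd_coupling` (an admissible
problem has a bistochastic coupling), `IsBrodingerMinimiser.entropy_eq_value`,
`map_eval_reversibleBrownianLaw` (every marginal of `R` is `vol`: incompressibility of `R`), and
the non-vacuity witness `isBrodingerMinimiser_reversibleBrownianLaw`: `R` is the Brödinger
minimiser for its own endpoint coupling `R_{t₀t₁}` (ACLZ (1): `H(P|R) = 0 ↔ P = R`).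

## Design notes / what is NOT here

* Time window `[t₀, t₁]` instead of ACLZ's `[0, 1]` (Brenier's minimality windows,
  *Hidden Convexity* Thm. 3.1.1, are stated on `[t₀, t₁]`); dimension `d` general (`𝕋³ = Fin 3`).
* Bistochasticity of `π` and finiteness of `H(π | vol ⊗ vol)` are **not** fields of
  `BrodingerProblem` (they are consequences of admissibility / hypotheses of the existence fact),
  so that data can be formed from any coupling without proof obligations.
* No existence/uniqueness of minimisers, no dual problem / pressure (ACLZ §2, to be vendored as
  named facts), no `ℝᵈ` version (σ-finite `R`, ACLZ p. 4), no Girsanov identity.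
* Junk values: `reversibleBrownianLaw` with `ν ≤ 0` is the law of the constant path from `vol`
  (`Real.sqrt` of a nonpositive number is `0`); `TorusPath.extend` is constant outside the window;
  `driftLaw` is `Classical.epsilon` (an arbitrary measure if the martingale problem had no
  solution — it is well posed for smooth `u`, Karatzas–Shreve Thm. 5.2.9 / Cor. 5.4.9, a fact not
  vendored here).

## References

* M. Arnaudon, A. B. Cruzeiro, C. Léonard, J.-C. Zambrini, *An entropic interpolation problem for
  incompressible viscous fluids*, AIHP PS 56 (2020) 2211–2235, arXiv:1704.02126. [ArnaudonEtAl2020]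
* A. Baradat, L. Monsaingeon, *Small noise limit and convexity for generalized incompressible
  flows, Schrödinger problems, and optimal transport*, ARMA 235 (2020), arXiv:1810.12036.
  [BaradatMonsaingeon2019]
* Y. Brenier, *Examples of Hidden Convexity in Nonlinear PDEs* (2020), §5.3.
  [Brenier2020HiddenConvexity]
* I. Karatzas, S. Shreve, *Brownian Motion and Stochastic Calculus* (1988), §5.4.
  [KaratzasShreve1988]
-/

noncomputable section

open MeasureTheory Set Filter
open scoped ENNReal NNReal RealInnerProductSpace

namespace Literature.Analysis.FluidPDE

open Literature.Analysis.FunctionSpaces Literature.Probability.Process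

/-! ### The path space `C([t₀, t₁]; 𝕋ᵈ)` -/

/-- The **path space** `Ω = C([t₀, t₁]; 𝕋ᵈ)` of continuous paths in the flat torus on the time
window `[t₀, t₁]`, with the compact-open (= uniform) topology (ACLZ, Notation, "Path space":
`Ω := C([0,1], 𝒳)`). A `def` synonym of `C(Set.Icc t₀ t₁, UnitAddTorus d)` carrying global Borel
instances. [cite: ArnaudonEtAl2020, Notation (Path space)] -/
def TorusPath (d : Type*) (t₀ t₁ : ℝ) : Type _ := C(Set.Icc t₀ t₁, UnitAddTorus d)

namespace TorusPath

variable {d : Type*} {t₀ t₁ : ℝ}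

/-- The compact-open topology on path space (that of `C(Set.Icc t₀ t₁, UnitAddTorus d)`).
[folklore] -/
instance instTopologicalSpace : TopologicalSpace (TorusPath d t₀ t₁) :=
  inferInstanceAs (TopologicalSpace C(Set.Icc t₀ t₁, UnitAddTorus d))

/-- The Borel σ-algebra of path space; it is the σ-algebra generated by the coordinate process
(ACLZ, Notation: "`Ω` is equipped with the canonical σ-field `σ(X_t; 0 ≤ t ≤ 1)`";
`Literature.Probability.Process.borel_continuousMap_eq_iSup_comap_eval`). [folklore] -/
instance instMeasurableSpace : MeasurableSpace (TorusPath d t₀ t₁) := borel _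

/-- Path space is a Borel space (by definition of its σ-algebra). [folklore] -/
instance instBorelSpace : BorelSpace (TorusPath d t₀ t₁) := ⟨rfl⟩

/-- Paths are functions of time (the `FunLike` structure of `C(Set.Icc t₀ t₁, UnitAddTorus d)`).
[folklore] -/
instance instFunLike : FunLike (TorusPath d t₀ t₁) (Set.Icc t₀ t₁) (UnitAddTorus d) :=
  inferInstanceAs (FunLike C(Set.Icc t₀ t₁, UnitAddTorus d) (Set.Icc t₀ t₁) (UnitAddTorus d))

/-- Paths are continuous maps. [folklore] -/
instance instContinuousMapClass :
    ContinuousMapClass (TorusPath d t₀ t₁) (Set.Icc t₀ t₁) (UnitAddTorus d) :=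
  inferInstanceAs (ContinuousMapClass C(Set.Icc t₀ t₁, UnitAddTorus d) (Set.Icc t₀ t₁) (UnitAddTorus d))

/-- A continuous map `[t₀, t₁] → 𝕋ᵈ` regarded as a path (the identity). [folklore] -/
def ofContinuousMap (f : C(Set.Icc t₀ t₁, UnitAddTorus d)) : TorusPath d t₀ t₁ := f

/-- A path regarded as a continuous map `[t₀, t₁] → 𝕋ᵈ` (the identity). [folklore] -/
def toContinuousMap (ω : TorusPath d t₀ t₁) : C(Set.Icc t₀ t₁, UnitAddTorus d) := ω

/-- Unfolding of `ofContinuousMap`. [folklore] -/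
@[simp] theorem ofContinuousMap_apply (f : C(Set.Icc t₀ t₁, UnitAddTorus d)) (t : Set.Icc t₀ t₁) :
    ofContinuousMap f t = f t := rfl

/-- Unfolding of `toContinuousMap`. [folklore] -/
@[simp] theorem toContinuousMap_apply (ω : TorusPath d t₀ t₁) (t : Set.Icc t₀ t₁) :
    ω.toContinuousMap t = ω t := rfl

/-- The **coordinate (canonical) process** `X_t(ω) = ω_t` on path space (ACLZ, Notation).
[cite: ArnaudonEtAl2020, Notation (Path space)] -/
def eval (t : Set.Icc t₀ t₁) (ω : TorusPath d t₀ t₁) : UnitAddTorus d := ω t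

/-- Unfolding of the coordinate process. [folklore] -/
@[simp] theorem eval_apply (t : Set.Icc t₀ t₁) (ω : TorusPath d t₀ t₁) : eval t ω = ω t := rfl

/-- Every path is continuous in time. [folklore] -/
theorem continuous_apply (ω : TorusPath d t₀ t₁) : Continuous fun t : Set.Icc t₀ t₁ => ω t :=
  ω.toContinuousMap.continuous

/-- Each coordinate map `ω ↦ ω_t` is continuous for the compact-open topology. [folklore] -/
theorem continuous_eval (t : Set.Icc t₀ t₁) : Continuous (eval t : TorusPath d t₀ t₁ → UnitAddTorus d) :=
  show Continuous fun ω : C(Set.Icc t₀ t₁, UnitAddTorus d) => ω t from continuous_eval_const t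

variable [Fintype d]

/-- Each coordinate map `ω ↦ ω_t` is Borel measurable. [folklore] -/
@[fun_prop]
theorem measurable_eval (t : Set.Icc t₀ t₁) : Measurable (eval t : TorusPath d t₀ t₁ → UnitAddTorus d) :=
  (continuous_eval t).measurable

/-- **A continuous-path process is a random path**: a map into path space is Borel measurable as
soon as all its coordinates are (`Literature.Probability.Process.measurable_continuousMap_of_eval`;
Billingsley (1999), §7). [cite: Billingsley1999, §7] -/
theorem measurable_of_eval {Ω : Type*} [MeasurableSpace Ω] {Φ : Ω → TorusPath d t₀ t₁}
    (h : ∀ t : Set.Icc t₀ t₁, Measurable fun ω => Φ ω t) : Measurable Φ :=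
  Literature.Probability.Process.measurable_continuousMap_of_eval (α := Set.Icc t₀ t₁)
    (β := UnitAddTorus d) (Φ := fun ω => (Φ ω).toContinuousMap) h

/-- The pair of **endpoint positions** `(X_{t₀}, X_{t₁})` (ACLZ, Notation: `Q₀₁ = (X₀, X₁)_# Q` is
"the endpoint projection"). [cite: ArnaudonEtAl2020, Notation (Marginal measures)] -/
def endpoints (h : t₀ ≤ t₁) (ω : TorusPath d t₀ t₁) : UnitAddTorus d × UnitAddTorus d :=
  (ω ⟨t₀, Set.left_mem_Icc.2 h⟩, ω ⟨t₁, Set.right_mem_Icc.2 h⟩)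

omit [Fintype d] in
/-- Unfolding of `endpoints`. [folklore] -/
@[simp] theorem endpoints_apply (h : t₀ ≤ t₁) (ω : TorusPath d t₀ t₁) :
    endpoints h ω = (ω ⟨t₀, Set.left_mem_Icc.2 h⟩, ω ⟨t₁, Set.right_mem_Icc.2 h⟩) := rfl

/-- The endpoint map is measurable. [folklore] -/
@[fun_prop]
theorem measurable_endpoints (h : t₀ ≤ t₁) : Measurable (endpoints (d := d) h) :=
  (measurable_eval _).prodMk (measurable_eval _)

omit [Fintype d] in
/-- The **extension of a path to all real times**, constant before `t₀` and after `t₁`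
(Mathlib `Set.IccExtend`); used to write time integrals `∫_{t₀}^{t} g(s, ω_s) ds` as interval
integrals over `ℝ`. [folklore] -/
def extend (h : t₀ ≤ t₁) (ω : TorusPath d t₀ t₁) : ℝ → UnitAddTorus d :=
  Set.IccExtend h ω

omit [Fintype d] in
/-- On the window the extension is the path. [folklore] -/
@[simp] theorem extend_of_mem (h : t₀ ≤ t₁) (ω : TorusPath d t₀ t₁) {s : ℝ} (hs : s ∈ Set.Icc t₀ t₁) :
    extend h ω s = ω ⟨s, hs⟩ :=
  Set.IccExtend_of_mem h ω hs

omit [Fintype d] in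
/-- The extended path is continuous on `ℝ`. [folklore] -/
theorem continuous_extend (h : t₀ ≤ t₁) (ω : TorusPath d t₀ t₁) : Continuous (extend h ω) :=
  (continuous_apply ω).Icc_extend'

/-- The **raw canonical filtration** `𝓑_t = σ(X_s : s ≤ t)` of path space (Mathlib
`Filtration.natural` of the coordinate process; neither completed nor made right continuous —
Karatzas–Shreve §5.4, Problem 4.13: for the martingale problem the raw filtration may be used).
[cite: KaratzasShreve1988, §5.4 Problem 4.13] -/
def canonicalFiltration : Filtration (Set.Icc t₀ t₁) (instMeasurableSpace : MeasurableSpace (TorusPath d t₀ t₁)) :=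
  Filtration.natural (fun t => eval (d := d) (t₀ := t₀) (t₁ := t₁) t)
    fun t => (measurable_eval t).stronglyMeasurable

end TorusPath

/-! ### The reversible Brownian path measure `R` (ACLZ Def. 1) -/

section Reference

variable (d : Type*) [Fintype d]

/-- The **noise space measure** behind the construction of `R`: a uniformly distributed starting
point on `𝕋ᵈ` and `d` independent canonical Wiener spaces,
`vol ⊗ (preWienerMeasure)^{⊗ d}` on `𝕋ᵈ × (d → (ℝ≥0 → ℝ))`. [folklore] -/
def torusBrownianNoise : Measure (UnitAddTorus d × (d → (ℝ≥0 → ℝ))) :=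
  (volume : Measure (UnitAddTorus d)).prod (Measure.pi fun _ : d => preWienerMeasure)

variable {d}

/-- The increment `√(2ν) W_{t−t₀}(β) ∈ ℝᵈ` of the `d`-dimensional Brownian motion
`W = (brownian · (β i))ᵢ` read off the noise coordinates `β`, scaled to diffusion coefficient
`a = 2ν` (generator `νΔ`); `Real.sqrt (2ν) = 0` for `ν ≤ 0` (junk). [folklore] -/
def brownianDisplacement (ν t₀ : ℝ) {t₁ : ℝ} (t : Set.Icc t₀ t₁) (β : d → (ℝ≥0 → ℝ)) :
    EuclideanSpace ℝ d :=
  WithLp.toLp 2 fun i => Real.sqrt (2 * ν) * brownian ⟨(t : ℝ) - t₀, sub_nonneg.2 t.2.1⟩ (β i)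

omit [Fintype d] in
/-- Coordinates of the projected Brownian displacement: `proj (√(2ν) W) i = √(2ν) Wⁱ (mod 1)`.
[folklore] -/
@[simp] theorem proj_brownianDisplacement_apply (ν t₀ : ℝ) {t₁ : ℝ} (t : Set.Icc t₀ t₁)
    (β : d → (ℝ≥0 → ℝ)) (i : d) :
    Torus.proj (brownianDisplacement ν t₀ t β) i =
      ((Real.sqrt (2 * ν) * brownian ⟨(t : ℝ) - t₀, sub_nonneg.2 t.2.1⟩ (β i) : ℝ) : UnitAddCircle) :=
  rfl

/-- The time shift `t ↦ t − t₀ : [t₀, t₁] → ℝ≥0` is continuous. [folklore] -/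
theorem continuous_subStart (t₀ t₁ : ℝ) :
    Continuous fun t : Set.Icc t₀ t₁ => (⟨(t : ℝ) - t₀, sub_nonneg.2 t.2.1⟩ : ℝ≥0) :=
  (continuous_subtype_val.sub continuous_const).subtype_mk _

omit [Fintype d] in
/-- The projected Brownian displacement is continuous in time (paths of `brownian` are
continuous by construction). [folklore] -/
theorem continuous_proj_brownianDisplacement (ν t₀ t₁ : ℝ) (β : d → (ℝ≥0 → ℝ)) :
    Continuous fun t : Set.Icc t₀ t₁ => Torus.proj (brownianDisplacement ν t₀ t β) := by
  refine continuous_pi fun i => ?_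
  simp only [proj_brownianDisplacement_apply]
  exact (AddCircle.continuous_mk' (1 : ℝ)).comp
    (continuous_const.mul ((continuous_brownian (β i)).comp (continuous_subStart t₀ t₁)))

omit [Fintype d] in
/-- The projected Brownian displacement at a fixed time is measurable in the noise. [folklore] -/
theorem measurable_proj_brownianDisplacement (ν t₀ : ℝ) {t₁ : ℝ} (t : Set.Icc t₀ t₁) :
    Measurable fun β : d → (ℝ≥0 → ℝ) => Torus.proj (brownianDisplacement ν t₀ t β) := by
  refine measurable_pi_lambda _ fun i => ?_
  simp only [proj_brownianDisplacement_apply]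
  exact AddCircle.measurable_mk'.comp
    (((measurable_brownian _).comp (measurable_pi_apply i)).const_mul _)

/-- The **Brownian path on the torus** started at `x` and driven by the noise `β`:
`t ↦ x + proj(√(2ν) W_{t−t₀}(β))`, the projection to `𝕋ᵈ = ℝᵈ/ℤᵈ` of a Euclidean Brownian
motion with diffusion coefficient `2ν` (ACLZ Def. 1: `Rˣ` is the law of `x + √a B`).
[cite: ArnaudonEtAl2020, Def. 1] -/
def torusBrownianPath (ν t₀ t₁ : ℝ) (x : UnitAddTorus d) (β : d → (ℝ≥0 → ℝ)) : TorusPath d t₀ t₁ :=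
  TorusPath.ofContinuousMap
    { toFun := fun t => x + Torus.proj (brownianDisplacement ν t₀ t β)
      continuous_toFun := continuous_const.add (continuous_proj_brownianDisplacement ν t₀ t₁ β) }

omit [Fintype d] in
/-- Unfolding of the torus Brownian path. [folklore] -/
@[simp] theorem torusBrownianPath_apply (ν t₀ t₁ : ℝ) (x : UnitAddTorus d) (β : d → (ℝ≥0 → ℝ))
    (t : Set.Icc t₀ t₁) :
    torusBrownianPath ν t₀ t₁ x β t = x + Torus.proj (brownianDisplacement ν t₀ t β) := rfl

/-- The noise-to-path map `(x, β) ↦ torusBrownianPath ν t₀ t₁ x β` is measurable (coordinatewise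
measurability suffices, `TorusPath.measurable_of_eval`). [folklore] -/
theorem measurable_torusBrownianPath (ν t₀ t₁ : ℝ) :
    Measurable fun p : UnitAddTorus d × (d → (ℝ≥0 → ℝ)) => torusBrownianPath ν t₀ t₁ p.1 p.2 := by
  refine TorusPath.measurable_of_eval fun t => ?_
  simp only [torusBrownianPath_apply]
  exact measurable_fst.add ((measurable_proj_brownianDisplacement ν t₀ t).comp measurable_snd)

variable (d)

/-- The **reversible Brownian path measure** `R = ∫ Rˣ vol(dx)` on `C([t₀, t₁]; 𝕋ᵈ)`
(ACLZ Def. 1), at diffusion coefficient `a = 2ν` (generator `νΔ`, the reference measure for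
Navier–Stokes with viscosity `ν`, ACLZ Thm. 24; Baradat–Monsaingeon's `R^{2ν}`): the law of the
torus Brownian path under the noise measure `vol ⊗ (preWienerMeasure)^{⊗ d}`. A probability
measure (`𝕋ᵈ` has volume one). Junk: for `ν ≤ 0` the law of the constant path started from `vol`.
[cite: ArnaudonEtAl2020, Def. 1] -/
def reversibleBrownianLaw (ν t₀ t₁ : ℝ) : Measure (TorusPath d t₀ t₁) :=
  (torusBrownianNoise d).map fun p => torusBrownianPath ν t₀ t₁ p.1 p.2

/-- The noise measure is a probability measure (the pre-Wiener measure is one, unconditionally: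
Kolmogorov extension, `Literature.Probability.Process.exists_isProjectiveLimit_holds`).
[folklore] -/
instance isProbabilityMeasure_torusBrownianNoise : IsProbabilityMeasure (torusBrownianNoise d) := by
  haveI : IsProbabilityMeasure preWienerMeasure :=
    isProbabilityMeasure_preWienerMeasure
      (isProjectiveLimit_preWienerMeasure_of exists_isProjectiveLimit_holds)
  unfold torusBrownianNoise
  infer_instance

/-- `R` is a probability measure (ACLZ p. 7: "when `𝒳 = 𝕋ⁿ`, `R ∈ P(Ω)` is a probability
measure"). [cite: ArnaudonEtAl2020, §1 (Introducing the Brownian motion)] -/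
instance isProbabilityMeasure_reversibleBrownianLaw (ν t₀ t₁ : ℝ) :
    IsProbabilityMeasure (reversibleBrownianLaw d ν t₀ t₁) :=
  Measure.isProbabilityMeasure_map (measurable_torusBrownianPath ν t₀ t₁).aemeasurable

/-- **Incompressibility of `R`**: every time marginal of the reversible Brownian path measure is
the volume measure, `(X_t)_# R = vol` (the starting point is uniform and independent of the
Brownian displacement, and `vol` is translation invariant; ACLZ §1, fundamental example on the
torus: `R₀ = vol` "so that `R` is reversible", `μ_t = vol`). [cite: ArnaudonEtAl2020, §1 (Fundamental example on the torus)] -/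
theorem map_eval_reversibleBrownianLaw (ν t₀ t₁ : ℝ) (t : Set.Icc t₀ t₁) :
    (reversibleBrownianLaw d ν t₀ t₁).map (TorusPath.eval t) = volume := by
  haveI : IsProbabilityMeasure preWienerMeasure :=
    isProbabilityMeasure_preWienerMeasure
      (isProjectiveLimit_preWienerMeasure_of exists_isProjectiveLimit_holds)
  set G : (d → (ℝ≥0 → ℝ)) → UnitAddTorus d := fun β => Torus.proj (brownianDisplacement ν t₀ t β)
    with hG
  have hGm : Measurable G := measurable_proj_brownianDisplacement ν t₀ t
  have hcomp : TorusPath.eval t ∘ (fun p : UnitAddTorus d × (d → (ℝ≥0 → ℝ)) =>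
      torusBrownianPath ν t₀ t₁ p.1 p.2) = fun p => p.1 + G p.2 := by
    funext p
    simp [G]
  rw [reversibleBrownianLaw, Measure.map_map (TorusPath.measurable_eval t)
    (measurable_torusBrownianPath ν t₀ t₁), hcomp]
  have hFm : Measurable fun p : UnitAddTorus d × (d → (ℝ≥0 → ℝ)) => p.1 + G p.2 :=
    measurable_fst.add (hGm.comp measurable_snd)
  ext s hs
  rw [Measure.map_apply hFm hs, torusBrownianNoise, Measure.prod_apply_symm (hFm hs)]
  have hslice : ∀ β : d → (ℝ≥0 → ℝ),
      (volume : Measure (UnitAddTorus d))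
        ((fun x : UnitAddTorus d => (x, β)) ⁻¹' ((fun p : UnitAddTorus d × (d → (ℝ≥0 → ℝ)) =>
          p.1 + G p.2) ⁻¹' s)) = volume s := by
    intro β
    have : (fun x : UnitAddTorus d => (x, β)) ⁻¹'
        ((fun p : UnitAddTorus d × (d → (ℝ≥0 → ℝ)) => p.1 + G p.2) ⁻¹' s) =
        (fun x : UnitAddTorus d => x + G β) ⁻¹' s := rfl
    rw [this, measure_preimage_add_right]
  simp_rw [hslice]
  rw [lintegral_const, Measure.pi_univ]
  simp

end Reference

/-! ### The Brödinger problem: data, admissible class, entropy, minimisers -/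

/-- The **data of a Brödinger problem** on the flat torus `𝕋ᵈ` (ACLZ (14) / (Bdg) with `𝒯 = [0,1]`,
`μ_t = vol`; Baradat–Monsaingeon §2.1, `Brö_ν(γ)`): a viscosity `ν > 0` (reference measure
`reversibleBrownianLaw d ν t₀ t₁`, generator `νΔ`), a nondegenerate time window `[t₀, t₁]`
(ACLZ: `[0, 1]`), and an endpoint coupling `π = coupling`, a measure on `𝕋ᵈ × 𝕋ᵈ`. That `π` be a
bistochastic probability measure is necessary for the admissible class to be nonempty
(`IsAdmissible.fst_coupling`) but is deliberately not part of the data.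
[cite: ArnaudonEtAl2020, §1 eq. (14) and (Bdg)] -/
structure BrodingerProblem (d : Type*) where
  /-- The viscosity `ν`: the reference Brownian motion has generator `νΔ` (ACLZ's `a = 2ν`). -/
  ν : ℝ
  /-- The initial time of the window. -/
  t₀ : ℝ
  /-- The final time of the window. -/
  t₁ : ℝ
  /-- The viscosity is positive. -/
  pos : 0 < ν
  /-- The window is nondegenerate. -/
  lt : t₀ < t₁
  /-- The prescribed endpoint coupling `π` of `(X_{t₀}, X_{t₁})`. -/
  coupling : Measure (UnitAddTorus d × UnitAddTorus d)

namespace BrodingerProblem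

variable {d : Type*} [Fintype d] (D : BrodingerProblem d)

omit [Fintype d] in
/-- `t₀ ≤ t₁`. [folklore] -/
theorem le : D.t₀ ≤ D.t₁ := D.lt.le

/-- The **reference measure** of the problem: the reversible Brownian path measure with generator
`νΔ` on `C([t₀, t₁]; 𝕋ᵈ)` (ACLZ Def. 1). [cite: ArnaudonEtAl2020, Def. 1] -/
def reference : Measure (TorusPath d D.t₀ D.t₁) := reversibleBrownianLaw d D.ν D.t₀ D.t₁

/-- The reference measure is a probability measure. [folklore] -/
instance isProbabilityMeasure_reference : IsProbabilityMeasure D.reference := by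
  unfold reference; infer_instance

/-- The endpoint projection `(X_{t₀}, X_{t₁})` of the problem's path space. [folklore] -/
abbrev endpoints : TorusPath d D.t₀ D.t₁ → UnitAddTorus d × UnitAddTorus d :=
  TorusPath.endpoints D.le

/-- The **admissible class** (ACLZ (14): `Q ∈ P(Ω)`, `Q_t = vol ∀ 0 ≤ t ≤ 1`, `Q₀₁ = π`;
Baradat–Monsaingeon §2.1 (i)–(ii)): a measure `P` on `C([t₀, t₁]; 𝕋ᵈ)` is admissible when every
time marginal is the volume measure (incompressibility, for **every** `t`) and its endpoint
coupling is the prescribed `π`. Such a `P` is automatically a probability measure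
(`IsAdmissible.isProbabilityMeasure`). Finiteness of the entropy is *not* required here (it is
part of `IsBrodingerMinimiser`, as in Baradat–Monsaingeon (iii)').
[cite: ArnaudonEtAl2020, §1 eq. (14)] -/
structure IsAdmissible (P : Measure (TorusPath d D.t₀ D.t₁)) : Prop where
  /-- Incompressibility: `(X_t)_# P = vol` for every `t ∈ [t₀, t₁]`. -/
  map_eval : ∀ t : Set.Icc D.t₀ D.t₁, P.map (TorusPath.eval t) = volume
  /-- Endpoint constraint: `(X_{t₀}, X_{t₁})_# P = π`. -/
  map_endpoints : P.map D.endpoints = D.coupling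

/-- The **Brödinger functional**: the relative entropy `H(P | R) ∈ [0, ∞]` of a path measure with
respect to the reversible Brownian path measure (ACLZ (14), "Relative entropy" p. 4; Mathlib's
`InformationTheory.klDiv`, which for probability measures is `∫ log (dP/dR) dP` if `P ≪ R` and the
log-likelihood ratio is integrable, and `∞` otherwise — ACLZ's convention on `P(Ω)`). By Girsanov it
equals `(1/4ν) E_P ∫ |v^P_t|² dt` on admissible `P` (ACLZ (13), not proved here).
[cite: ArnaudonEtAl2020, §1 eq. (14)] -/
def entropy (P : Measure (TorusPath d D.t₀ D.t₁)) : ℝ≥0∞ :=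
  InformationTheory.klDiv P D.reference

/-- The **value** `inf {H(P | R) : P admissible} ∈ [0, ∞]` of the Brödinger problem (`∞` if the
admissible class is empty; ACLZ Prop. 2: a solution exists iff the value is finite).
[cite: ArnaudonEtAl2020, Prop. 2] -/
def value : ℝ≥0∞ :=
  ⨅ (P : Measure (TorusPath d D.t₀ D.t₁)) (_ : D.IsAdmissible P), D.entropy P

end BrodingerProblem

/-- **Solutions (minimisers) of the Brödinger problem** (ACLZ (14) and Prop. 2;
Baradat–Monsaingeon §2.1: "a solution to `Brö_ν(γ)` is an admissible generalized flow that
minimizes `𝓗_ν` in the set of all admissible generalized flows", admissibility there including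
finite entropy (iii)'): `P` is admissible, has finite relative entropy with respect to `R`, and no
admissible path measure has smaller entropy. [cite: BaradatMonsaingeon2019, §2.1 (Brödinger problem)] -/
structure IsBrodingerMinimiser {d : Type*} [Fintype d] (D : BrodingerProblem d)
    (P : Measure (TorusPath d D.t₀ D.t₁)) : Prop where
  /-- A minimiser is admissible. -/
  isAdmissible : D.IsAdmissible P
  /-- A minimiser has finite entropy. -/
  entropy_lt_top : D.entropy P < ∞
  /-- A minimiser minimises the entropy over the admissible class. -/
  entropy_le : ∀ Q : Measure (TorusPath d D.t₀ D.t₁), D.IsAdmissible Q → D.entropy P ≤ D.entropy Q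

namespace BrodingerProblem

variable {d : Type*} [Fintype d] {D : BrodingerProblem d} {P : Measure (TorusPath d D.t₀ D.t₁)}

/-- An admissible path measure is a probability measure (its `t₀`-marginal is `vol`, a
probability measure). [folklore] -/
theorem IsAdmissible.isProbabilityMeasure (h : D.IsAdmissible P) : IsProbabilityMeasure P := by
  constructor
  have := congrArg (fun μ : Measure (UnitAddTorus d) => μ Set.univ)
    (h.map_eval ⟨D.t₀, Set.left_mem_Icc.2 D.le⟩)
  simpa [Measure.map_apply (TorusPath.measurable_eval _) MeasurableSet.univ] using this

/-- **Bistochasticity is necessary, first marginal**: if the admissible class is nonempty then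
the first marginal of the coupling `π` is `vol` (ACLZ p. 7: "for this problem to admit a solution,
it is necessary that … `π₀ = μ₀`"). [cite: ArnaudonEtAl2020, §1 (Bredinger's problem)] -/
theorem IsAdmissible.fst_coupling (h : D.IsAdmissible P) : D.coupling.fst = volume := by
  rw [← h.map_endpoints, Measure.fst, Measure.map_map measurable_fst (TorusPath.measurable_endpoints D.le)]
  exact h.map_eval ⟨D.t₀, Set.left_mem_Icc.2 D.le⟩

/-- **Bistochasticity is necessary, second marginal**: if the admissible class is nonempty then
the second marginal of the coupling `π` is `vol` (ACLZ p. 7, `π₁ = μ₁`).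
[cite: ArnaudonEtAl2020, §1 (Bredinger's problem)] -/
theorem IsAdmissible.snd_coupling (h : D.IsAdmissible P) : D.coupling.snd = volume := by
  rw [← h.map_endpoints, Measure.snd, Measure.map_map measurable_snd (TorusPath.measurable_endpoints D.le)]
  exact h.map_eval ⟨D.t₁, Set.right_mem_Icc.2 D.le⟩

/-- The coupling of a problem with nonempty admissible class is a probability measure. [folklore] -/
theorem IsAdmissible.isProbabilityMeasure_coupling (h : D.IsAdmissible P) :
    IsProbabilityMeasure D.coupling := by
  haveI := h.isProbabilityMeasure
  rw [← h.map_endpoints]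
  exact Measure.isProbabilityMeasure_map (TorusPath.measurable_endpoints D.le).aemeasurable

/-- The value is a lower bound for the entropy of every admissible measure. [folklore] -/
theorem value_le_entropy (h : D.IsAdmissible P) : D.value ≤ D.entropy P :=
  iInf₂_le P h

/-- The reference measure has entropy zero with respect to itself (ACLZ (1)). [folklore] -/
theorem entropy_reference (D : BrodingerProblem d) : D.entropy D.reference = 0 := by
  unfold entropy
  exact InformationTheory.klDiv_self _

end BrodingerProblem

namespace IsBrodingerMinimiser

variable {d : Type*} [Fintype d] {D : BrodingerProblem d} {P : Measure (TorusPath d D.t₀ D.t₁)}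

/-- A minimiser is a probability measure. [folklore] -/
theorem isProbabilityMeasure (h : IsBrodingerMinimiser D P) : IsProbabilityMeasure P :=
  h.isAdmissible.isProbabilityMeasure

/-- A minimiser attains the value of the problem: `H(P | R) = inf_{admissible} H(· | R)`. [folklore] -/
theorem entropy_eq_value (h : IsBrodingerMinimiser D P) : D.entropy P = D.value :=
  le_antisymm (le_iInf₂ h.entropy_le) (BrodingerProblem.value_le_entropy h.isAdmissible)

/-- The value of a problem admitting a minimiser is finite (the easy direction of ACLZ Prop. 2).
[cite: ArnaudonEtAl2020, Prop. 2] -/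
theorem value_lt_top (h : IsBrodingerMinimiser D P) : D.value < ∞ :=
  h.entropy_eq_value ▸ h.entropy_lt_top

end IsBrodingerMinimiser

/-! ### The classical embedding `u ↦ Pᵘ` (martingale-problem form) -/

section Drift

variable {d : Type*} [Fintype d] {t₀ t₁ : ℝ}

/-- The (time-dependent) **generator** `L_s f = νΔf + ⟪u(s, ·), ∇f⟫` of the diffusion
`dX = u(s, X) ds + √(2ν) dW` acting on a function on the torus (ACLZ p. 7:
`L_t = v·∇ + aΔ/2` with `a = 2ν`; Karatzas–Shreve (5.4.1)). [cite: ArnaudonEtAl2020, §1 (Introducing the Brownian motion)] -/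
def driftGenerator (ν : ℝ) (u : ℝ → UnitAddTorus d → EuclideanSpace ℝ d) (f : UnitAddTorus d → ℝ)
    (s : ℝ) (x : UnitAddTorus d) : ℝ :=
  ν * Torus.laplacian f x + ⟪u s x, Torus.gradient f x⟫

/-- The **martingale-problem functional** `M^f_t(ω) = f(ω_t) − ∫_{t₀}^{t} (L_s f)(ω_s) ds` of a test
function `f` along a path (Karatzas–Shreve (5.4.8), up to the `𝓑_{t₀}`-measurable constant
`f(ω_{t₀})`, which does not affect the martingale property). The time integral is an interval
integral of the constantly extended path. [cite: KaratzasShreve1988, §5.4 eq. (4.8)] -/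
def dynkinFunctional (ν : ℝ) (u : ℝ → UnitAddTorus d → EuclideanSpace ℝ d) (f : UnitAddTorus d → ℝ)
    (h : t₀ ≤ t₁) (t : Set.Icc t₀ t₁) (ω : TorusPath d t₀ t₁) : ℝ :=
  f (ω t) - ∫ s in t₀..(t : ℝ), driftGenerator ν u f s (TorusPath.extend h ω s)

/-- **The classical embedding, as a predicate**: `P` is *the law on `[t₀, t₁]`, started from the
volume measure, of the diffusion `dX = u(t, X) dt + √(2ν) dW`* — in the Stroock–Varadhan form:
`P` is a probability measure on `C([t₀, t₁]; 𝕋ᵈ)` with `(X_{t₀})_# P = vol` under which, for every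
smooth `f : 𝕋ᵈ → ℝ`, `f(X_t) − ∫_{t₀}^{t} (νΔf + ⟪u_s, ∇f⟫)(X_s) ds` is a martingale for the raw
canonical filtration (ACLZ p. 7: a finite-entropy `Q` "is the unique solution … of the martingale
problem associated with `L_t = v·∇ + aΔ/2`"; Karatzas–Shreve §5.4 Def. 4.10 and Prop. 4.11:
solutions of the martingale problem = laws of weak solutions; Problem 4.13: raw filtration).
Test functions: Karatzas–Shreve use `C²₀(ℝᵈ)`; on the compact torus we use `C^∞(𝕋ᵈ)`
(`Torus.IsSmooth`), which asks for fewer martingales — every law of a weak solution satisfies it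
(Itô), and for smooth `u` it still determines the law (well-posedness). For a smooth
divergence-free `u` this `P` is incompressible and is the candidate Brödinger minimiser of
Brenier's minimality theorem (neither proved here). [cite: KaratzasShreve1988, §5.4 Def. 4.10] -/
structure IsDriftLaw (ν t₀ t₁ : ℝ) (u : ℝ → UnitAddTorus d → EuclideanSpace ℝ d)
    (P : Measure (TorusPath d t₀ t₁)) : Prop where
  /-- The window is a genuine interval. -/
  le : t₀ ≤ t₁
  /-- `P` is a probability measure. -/
  isProbabilityMeasure : IsProbabilityMeasure P
  /-- The initial law is the volume measure: `(X_{t₀})_# P = vol`. -/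
  map_eval_start : P.map (TorusPath.eval ⟨t₀, Set.left_mem_Icc.2 le⟩) = volume
  /-- The martingale problem for `L_s = νΔ + u(s, ·)·∇` on smooth test functions. -/
  martingale : ∀ f : UnitAddTorus d → ℝ, Torus.IsSmooth f →
    Martingale (dynkinFunctional ν u f le) TorusPath.canonicalFiltration P

/-- **The classical embedding `u ↦ Pᵘ`**: a path measure chosen (by `Classical.epsilon`) among the
solutions of the martingale problem `IsDriftLaw ν t₀ t₁ u`, i.e. *the* law of
`dX = u(t, X) dt + √(2ν) dW`, `X_{t₀} ∼ vol`, whenever that problem is well posed (it is for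
smooth `u`: Karatzas–Shreve Thm. 5.2.9 with Cor. 5.4.9, a fact not vendored here). **Junk value**:
an arbitrary measure if the martingale problem has no solution. [cite: KaratzasShreve1988, §5.4 Def. 4.10] -/
def driftLaw (ν t₀ t₁ : ℝ) (u : ℝ → UnitAddTorus d → EuclideanSpace ℝ d) : Measure (TorusPath d t₀ t₁) :=
  Classical.epsilon (IsDriftLaw ν t₀ t₁ u)

/-- If the martingale problem has a solution, `driftLaw ν t₀ t₁ u` is one. [folklore] -/
theorem isDriftLaw_driftLaw {ν : ℝ} {u : ℝ → UnitAddTorus d → EuclideanSpace ℝ d}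
    (h : ∃ P : Measure (TorusPath d t₀ t₁), IsDriftLaw ν t₀ t₁ u P) :
    IsDriftLaw ν t₀ t₁ u (driftLaw ν t₀ t₁ u) :=
  Classical.epsilon_spec h

end Drift

/-! ### Posing the problem with a path measure's own endpoint coupling -/

namespace BrodingerProblem

variable {d : Type*} [Fintype d]

/-- The Brödinger problem **posed by a path measure**: viscosity `ν`, window `[t₀, t₁]`, and as
coupling the endpoint law `(X_{t₀}, X_{t₁})_# P` of `P` itself (the setting of Brenier's
minimality theorem, *Hidden Convexity* Thm. 3.1.1, and of "the classical flow is the Brödinger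
minimiser for its own endpoint coupling"). [cite: Brenier2020HiddenConvexity, Thm. 3.1.1] -/
def ofPathMeasure (ν t₀ t₁ : ℝ) (pos : 0 < ν) (lt : t₀ < t₁) (P : Measure (TorusPath d t₀ t₁)) :
    BrodingerProblem d :=
  ⟨ν, t₀, t₁, pos, lt, P.map (TorusPath.endpoints lt.le)⟩

omit [Fintype d] in
/-- The coupling of `ofPathMeasure` is the endpoint law. [folklore] -/
@[simp] theorem coupling_ofPathMeasure (ν t₀ t₁ : ℝ) (pos : 0 < ν) (lt : t₀ < t₁)
    (P : Measure (TorusPath d t₀ t₁)) :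
    (ofPathMeasure ν t₀ t₁ pos lt P).coupling = P.map (TorusPath.endpoints lt.le) := rfl

/-- For the problem posed by `P` itself, `P` is admissible iff it is incompressible (the endpoint
constraint holds by definition). [folklore] -/
theorem isAdmissible_ofPathMeasure_self_iff (ν t₀ t₁ : ℝ) (pos : 0 < ν) (lt : t₀ < t₁)
    (P : Measure (TorusPath d t₀ t₁)) :
    (ofPathMeasure ν t₀ t₁ pos lt P).IsAdmissible P ↔
      ∀ t : Set.Icc t₀ t₁, P.map (TorusPath.eval t) = volume :=
  ⟨fun h => h.map_eval, fun h => ⟨h, rfl⟩⟩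

end BrodingerProblem

/-- **Non-vacuity / the trivial minimiser**: the reversible Brownian path measure `R` is the
Brödinger minimiser of the problem posed by its own endpoint coupling `R_{t₀t₁}` — it is
incompressible (`map_eval_reversibleBrownianLaw`) and `H(R | R) = 0 ≤ H(Q | R)` (ACLZ (1):
`H(P | R) = 0 ↔ P = R`, so it is in fact the unique one). [cite: ArnaudonEtAl2020, §Notation eq. (1)] -/
theorem isBrodingerMinimiser_reversibleBrownianLaw {d : Type*} [Fintype d] (ν t₀ t₁ : ℝ)
    (pos : 0 < ν) (lt : t₀ < t₁) :
    IsBrodingerMinimiser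
      (BrodingerProblem.ofPathMeasure ν t₀ t₁ pos lt (reversibleBrownianLaw d ν t₀ t₁))
      (reversibleBrownianLaw d ν t₀ t₁) where
  isAdmissible :=
    (BrodingerProblem.isAdmissible_ofPathMeasure_self_iff ν t₀ t₁ pos lt _).2
      (map_eval_reversibleBrownianLaw d ν t₀ t₁)
  entropy_lt_top := by
    have h : (BrodingerProblem.ofPathMeasure ν t₀ t₁ pos lt (reversibleBrownianLaw d ν t₀ t₁)).entropy
        (reversibleBrownianLaw d ν t₀ t₁) = 0 :=
      BrodingerProblem.entropy_reference _
    simp [h]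
  entropy_le Q _ := by
    have h : (BrodingerProblem.ofPathMeasure ν t₀ t₁ pos lt (reversibleBrownianLaw d ν t₀ t₁)).entropy
        (reversibleBrownianLaw d ν t₀ t₁) = 0 :=
      BrodingerProblem.entropy_reference _
    simp [h]

end Literature.Analysis.FluidPDE
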